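import Summits.Ventures.HodgeRepro2.HeckeCompositionNormalizer

/-!
# The other composition with a normalising element: `T_β ∘ T_α = T_{αβ}`

For `β ∈ U(H)(K)` normalising `S`: `T_β (T_α f) = (T_α f) ∥_k β = Σ_q f ∥_k (α r_q β)`, and the
`α r_q β = α β · (β⁻¹ r_q β)` run over the right cosets of `S α β S` because conjugation by `β`
maps `S_α = S ∩ α⁻¹ S α` onto `S_{αβ} = β⁻¹ S_α β`.  Together with `HeckeCompositionNormalizer.lean`
(`T_α ∘ T_β = T_{βα}`): `T_α` commutes with `T_β` as soon as `S αβ S = S βα S`.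
-/

namespace Summit.Ventures.HodgeRepro2.ShimuraData

open Matrix

variable {K : Type*} [Field K] [NumberField K] [NumberField.IsCMField K] {τ₁ : K →+* ℂ}
  {H : Matrix (Fin 3) (Fin 3) K} {Q : Matrix (Fin 3) (Fin 3) ℂ}

omit [NumberField K] [NumberField.IsCMField K] in
/-- Conjugation by a normalising `β` as an automorphism of `S`: `s ↦ β⁻¹ s β`. -/
def conjBySubgroup {S : Subgroup (GL (Fin 3) K)} {β : GL (Fin 3) K}
    (hβ : ∀ s : GL (Fin 3) K, s ∈ S ↔ β * s * β⁻¹ ∈ S) : S ≃ S where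
  toFun s := ⟨β⁻¹ * s * β, by
    have h := (hβ (β⁻¹ * s * β)).mpr (by
      have : β * (β⁻¹ * s * β) * β⁻¹ = s := by group
      rw [this]; exact s.property)
    exact h⟩
  invFun s := ⟨β * s * β⁻¹, (hβ s).mp s.property⟩
  left_inv s := by ext; simp only; group
  right_inv s := by ext; simp only; group

omit [NumberField K] [NumberField.IsCMField K] in
/-- `(conjBySubgroup hβ s : GL) = β⁻¹ s β`. -/
@[simp] theorem coe_conjBySubgroup {S : Subgroup (GL (Fin 3) K)} {β : GL (Fin 3) K}
    (hβ : ∀ s : GL (Fin 3) K, s ∈ S ↔ β * s * β⁻¹ ∈ S) (s : S) :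
    ((conjBySubgroup hβ s : S) : GL (Fin 3) K) = β⁻¹ * s * β := rfl

omit [NumberField K] [NumberField.IsCMField K] in
/-- `S_{αβ} = β⁻¹ S_α β` in the form needed for the quotients: `t ∈ S_α ↔ β⁻¹ t β ∈ S_{αβ}`. -/
theorem mem_heckeSubgroup_mul_right_iff {S : Subgroup (GL (Fin 3) K)} {β α : GL (Fin 3) K}
    (hβ : ∀ s : GL (Fin 3) K, s ∈ S ↔ β * s * β⁻¹ ∈ S) (t : GL (Fin 3) K) :
    t ∈ heckeSubgroup S α ↔ β⁻¹ * t * β ∈ heckeSubgroup S (α * β) := by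
  simp only [heckeSubgroup, Subgroup.mem_inf, Subgroup.mem_comap, MulEquiv.coe_toMonoidHom,
    MulAut.conj_apply]
  have key : α * β * (β⁻¹ * t * β) * (α * β)⁻¹ = α * t * α⁻¹ := by group
  rw [key]
  constructor
  · rintro ⟨h1, h2⟩
    refine ⟨?_, h2⟩
    have h := (hβ (β⁻¹ * t * β)).mpr (by
      have : β * (β⁻¹ * t * β) * β⁻¹ = t := by group
      rw [this]; exact h1)
    exact h
  · rintro ⟨h1, h2⟩
    refine ⟨?_, h2⟩
    have h := (hβ (β⁻¹ * t * β)).mp h1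
    have : β * (β⁻¹ * t * β) * β⁻¹ = t := by group
    rwa [this] at h

omit [NumberField K] [NumberField.IsCMField K] in
/-- The induced bijection `S / S_α ≃ S / S_{αβ}`, `s S_α ↦ (β⁻¹ s β) S_{αβ}`. -/
def heckeQuotientConj {S : Subgroup (GL (Fin 3) K)} {β α : GL (Fin 3) K}
    (hβ : ∀ s : GL (Fin 3) K, s ∈ S ↔ β * s * β⁻¹ ∈ S) :
    (S ⧸ (heckeSubgroup S α).subgroupOf S) ≃ (S ⧸ (heckeSubgroup S (α * β)).subgroupOf S) :=
  Quotient.congr (conjBySubgroup hβ) fun a b => by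
    rw [QuotientGroup.leftRel_apply, QuotientGroup.leftRel_apply, Subgroup.mem_subgroupOf,
      Subgroup.mem_subgroupOf]
    rw [mem_heckeSubgroup_mul_right_iff hβ]
    simp only [Subgroup.coe_mul, Subgroup.coe_inv, coe_conjBySubgroup]
    have : β⁻¹ * (((a : GL (Fin 3) K))⁻¹ * (b : GL (Fin 3) K)) * β =
        (β⁻¹ * (a : GL (Fin 3) K) * β)⁻¹ * (β⁻¹ * (b : GL (Fin 3) K) * β) := by group
    rw [this]

omit [NumberField K] [NumberField.IsCMField K] in
/-- `heckeQuotientConj` on classes. -/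
theorem heckeQuotientConj_mk {S : Subgroup (GL (Fin 3) K)} {β α : GL (Fin 3) K}
    (hβ : ∀ s : GL (Fin 3) K, s ∈ S ↔ β * s * β⁻¹ ∈ S) (s : S) :
    heckeQuotientConj (α := α) hβ (QuotientGroup.mk s) = QuotientGroup.mk (conjBySubgroup hβ s) :=
  Quotient.congr_mk _ _ s

omit [NumberField K] [NumberField.IsCMField K] in
/-- The slash is additive in the function. -/
theorem slash_sum {ι : Type*} (s : Finset ι) (k : ℕ) (B : Matrix (Fin 3) (Fin 3) ℂ)
    (g : ι → (Fin 2 → ℂ) → ℂ) (z : Fin 2 → ℂ) :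
    slash k B (fun w => ∑ i ∈ s, g i w) z = ∑ i ∈ s, slash k B (g i) z := by
  unfold slash
  rw [Finset.mul_sum]

/-- **`T_β ∘ T_α = T_{αβ}` for `β` normalising `S`** (on the ball, for weight-`k` forms for `S`). -/
theorem hecke_hecke_eq_hecke_mul_of_normalizes' (hQ : IsFrame K τ₁ H Q) {S : Subgroup (GL (Fin 3) K)}
    (hS : (S : Set (GL (Fin 3) K)) ⊆ (unitaryGroup K H : Set (GL (Fin 3) K)))
    {β α : GL (Fin 3) K} (hβ : ∀ s : GL (Fin 3) K, s ∈ S ↔ β * s * β⁻¹ ∈ S)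
    (hβU : β ∈ unitaryGroup K H) (hαU : α ∈ unitaryGroup K H)
    [Fintype (S ⧸ (heckeSubgroup S α).subgroupOf S)]
    [Fintype (S ⧸ (heckeSubgroup S β).subgroupOf S)]
    [Fintype (S ⧸ (heckeSubgroup S (α * β)).subgroupOf S)]
    {k : ℕ} {f : (Fin 2 → ℂ) → ℂ} (hf : IsWeightFor τ₁ Q S k f) {z : Fin 2 → ℂ} (hz : z ∈ ball₂) :
    hecke S β τ₁ Q k (hecke S α τ₁ Q k f) z = hecke S (α * β) τ₁ Q k f z := by
  have hB : IsInU21 (realEmbedding K τ₁ Q β) := hQ.isInU21_realEmbedding hβU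
  -- T_β of anything is the slash by β (on the ball); T_α f is weight-k for S? not needed: the
  -- identity `hecke S β g z = slash k (re β) g z` of row 147 is for weight-k g; instead expand
  -- `hecke S β` directly: its single term is `slash (re (β * r))` with r ∈ S_β = S ... we use the
  -- row-147 lemma applied to the weight-k form `T_α f`.
  have hTα : IsWeightFor τ₁ Q S k (hecke S α τ₁ Q k f) := IsWeightFor.hecke hQ S hS hαU hf
  rw [hecke_eq_slash_of_normalizes hQ hS hβ hβU hTα hz]
  -- LHS = slash k (re β) (fun w => Σ_q slash k (re (α r_q)) f w) z
  show slash k (realEmbedding K τ₁ Q β)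
      (fun w => ∑ q, slash k (realEmbedding K τ₁ Q (α * heckeRep S α q)) f w) z =
    ∑ q', slash k (realEmbedding K τ₁ Q (α * β * heckeRep S (α * β) q')) f z
  rw [slash_sum]
  refine Fintype.sum_equiv (heckeQuotientConj (α := α) hβ) _ _ fun q => ?_
  rw [← slash_mul k hB f hz, ← hQ.realEmbedding_mul]
  -- representatives: out (e q) ~ β⁻¹ (out q) β in S_{αβ}
  have hmk : (QuotientGroup.mk (Quotient.out (heckeQuotientConj (α := α) hβ q)) :
      S ⧸ (heckeSubgroup S (α * β)).subgroupOf S) =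
      QuotientGroup.mk (conjBySubgroup hβ (Quotient.out q)) := by
    rw [QuotientGroup.out_eq', ← heckeQuotientConj_mk hβ, QuotientGroup.out_eq']
  have hu := QuotientGroup.eq.mp hmk.symm
  rw [Subgroup.mem_subgroupOf] at hu
  set a := Quotient.out q with ha
  set b := Quotient.out (heckeQuotientConj (α := α) hβ q) with hb
  have hconj : α * β * (((conjBySubgroup hβ a)⁻¹ * b : S) : GL (Fin 3) K) * (α * β)⁻¹ ∈ S := by
    have := (Subgroup.mem_inf.mp hu).2
    simpa only [Subgroup.mem_comap, MulEquiv.coe_toMonoidHom, MulAut.conj_apply] using this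
  have hrel : α * heckeRep S α q * β =
      (α * β * (((conjBySubgroup hβ a)⁻¹ * b : S) : GL (Fin 3) K) * (α * β)⁻¹) *
        (α * β * heckeRep S (α * β) (heckeQuotientConj (α := α) hβ q)) := by
    unfold heckeRep
    rw [← ha, ← hb]
    simp only [Subgroup.coe_mul, Subgroup.coe_inv, coe_conjBySubgroup]
    group
  rw [hrel, slash_realEmbedding_mul_left hQ hS hf hconj
    ((unitaryGroup K H).mul_mem ((unitaryGroup K H).mul_mem hαU hβU)
      (hS (heckeRep S (α * β) (heckeQuotientConj (α := α) hβ q)).property)) hz]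

end Summit.Ventures.HodgeRepro2.ShimuraData
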